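import Summits.KontsevichZagierPeriods.KontsevichZagierPeriods.Theorems.SymplecticScissorsVolumeFormOffPlaneToricA
import Literature.NumberTheory.Transcendental.KZSemiCanonicalReductionProofs

/-!
# Toric assembly, part F: the sector statement in the crux's own shape (pairs of solids)

Helper file for the stub `stub_toricAssembly` of the line `Sketch` (card `log-polytope-hilbert-three`)
of the crux `VolumeFormOffPlane` (stmt-KontsevichZagierPeriods-14935), route `SymplecticScissors`.

The crux speaks of PAIRS of integrand-`1` representations with equal value. From the family form
of the rank-two toric box sector (the registered conclusion of `stub_toricAssembly`, taken here as
the hypothesis `hRTB`, and the existence of log-box representations, first conjunct of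
`stub_logBoxCut`) we derive the pair form on FINITE DISJOINT UNIONS of log-boxes: two
integrand-`1` representations of dimension `n + 1` whose domains are finite disjoint unions of
log-boxes with corners in `α^ℤ β^ℤ` (`α, β` multiplicatively independent positive real algebraic)
and with equal value are KZ-equivalent — `VolumeFormOffPlane` restricted to the toric rank-two
sector, in every dimension (iterated domain additivity `KZ.of_sub_sum_of_mem_relations` and
soundness `KZ.relations_le_ker_eval_holds` for the values of the pieces).
-/

noncomputable section

open MeasureTheory Set
open Literature.NumberTheory.Transcendental

namespace Summit.KontsevichZagierPeriods.SymplecticScissors.LogPolytope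

-- Shorthands used in the SOURCE of this file (work/toric/ToricF.src.lean, expanded by
-- work/toric/pp.py before checking/landing; the landed file is notation-free):
--   𝔅(n, a, b) = the log-box;  HExists = first conjunct of `stub_logBoxCut`;  RTB = conclusion of
--   `stub_toricAssembly` (both verbatim).

/-- **Splitting a finite disjoint union of log-boxes into its boxes** (iterated rule 1a): if the
domain of an integrand-`1` representation `r` is the disjoint union of the log-boxes over
`(a i, b i)` (positive real-algebraic corners), then for integrand-`1` representations `R i` on the
boxes, `[r] − ∑ [R i]` is a relation and the values add up. [folklore] -/
theorem toric_split_union : ∀ {n k : ℕ} (a b : Fin k → Fin n → ℝ) (r : KZ.IntegralRep (n + 1)) (R : Fin k → KZ.IntegralRep (n + 1)), r.domain = (⋃ i, {ξ : Fin (n + 1) → ℝ | (∀ ι : Fin n, (a i) ι < ξ (Fin.castSucc ι) ∧ ξ (Fin.castSucc ι) < (b i) ι) ∧ 0 < ξ (Fin.last n) ∧ ξ (Fin.last n) * ∏ ι : Fin n, ξ (Fin.castSucc ι) < 1}) → (∀ i i', i ≠ i' → Disjoint {ξ : Fin (n + 1) → ℝ | (∀ ι : Fin n, (a i) ι < ξ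 (Fin.castSucc ι) ∧ ξ (Fin.castSucc ι) < (b i) ι) ∧ 0 < ξ (Fin.last n) ∧ ξ (Fin.last n) * ∏ ι : Fin n, ξ (Fin.castSucc ι) < 1} {ξ : Fin (n + 1) → ℝ | (∀ ι : Fin n, (a i') ι < ξ (Fin.castSucc ι) ∧ ξ (Fin.castSucc ι) < (b i') ι) ∧ 0 < ξ (Fin.last n) ∧ ξ (Fin.last n) * ∏ ι : Fin n, ξ (Fin.castSucc ι) < 1}) → (∀ x ∈ r.domain, r.integrand x = 1) → (∀ i, (R i).domain = {ξ : Fin (n + 1) → ℝ | (∀ ι : Fin n, (a i) ι < ξ (Fin.castSucc ι) ∧ ξ (Fin.castSucc ι) < (b i) ι) ∧ 0 < ξ (Fin.last n) ∧ ξ (Fin.last n) * ∏ ι : Fin n, ξ (Fin.castSucc ι) < 1}) → (∀ i, ∀ x ∈ (R i).domain, (R i).integrand x = 1) → KZ.of r - ∑ i, KZ.of (R i) ∈ KZ.relations ∧ r.value = ∑ i, (R i).value := by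
  intro n k a b r R hrd hdisj hr hRd hR
  have hsub : ∀ i, (R i).domain ⊆ r.domain := by
    intro i x hx
    rw [hrd]
    exact mem_iUnion.mpr ⟨i, by simpa only [hRd i] using hx⟩
  have hrel : KZ.of r - ∑ i, KZ.of (R i) ∈ KZ.relations := by
    refine KZ.of_sub_sum_of_mem_relations Finset.univ r R (fun i _ => ?_) (fun i _ => ?_) ?_ ?_
    · rw [sdiff_eq_empty.mpr (hsub i), measure_empty]
    · intro x hx
      rw [hR i x hx.1, hr x hx.2]
    · have : r.domain \ ⋃ i ∈ (Finset.univ : Finset (Fin k)), (R i).domain = ∅ := by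
        refine sdiff_eq_empty.mpr fun x hx => ?_
        rw [hrd] at hx
        obtain ⟨i, hi⟩ := mem_iUnion.mp hx
        exact mem_biUnion (Finset.mem_univ i) (by rw [hRd i]; exact hi)
      rw [this, measure_empty]
    · intro i _ i' _ hii'
      have hd := hdisj i i' hii'
      rw [← hRd i, ← hRd i'] at hd
      rw [hd.inter_eq, measure_empty]
  refine ⟨hrel, ?_⟩
  have h0 := KZ.relations_le_ker_eval_holds hrel
  rw [AddMonoidHom.mem_ker, map_sub, map_sum, KZ.eval_of, sub_eq_zero] at h0
  simpa only [KZ.eval_of] using h0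

/-- **The toric rank-two sector of `VolumeFormOffPlane`, pair form.** Under the family form of the
sector (conclusion of `stub_toricAssembly`) and the existence of log-box representations: two
integrand-`1` representations of dimension `n + 1` whose domains are finite disjoint unions of
log-boxes with corners in `α^ℤ β^ℤ` (`α, β` multiplicatively independent positive real algebraic
numbers) and with equal value are KZ-equivalent. [folklore] -/
theorem toric_sector_pairs (hEx : (∀ (n : ℕ) (a b : Fin n → ℝ), (∀ j, 0 < a j) → (∀ j, IsAlgebraic ℚ (a j)) → (∀ j, IsAlgebraic ℚ (b j)) → ∃ r : KZ.IntegralRep (n + 1), r.domain = {p : Fin (n + 1) → ℝ | (∀ j : Fin n, a j < p (Fin.castSucc j) ∧ p (Fin.castSucc j) < b j) ∧ 0 < p (Fin.last n) ∧ p (Fin.last n) * ∏ j : Fin n, p (Fin.castSucc j) < 1} ∧ r.integrand = fun _ => 1)) (hRTB : (∀ (n : ℕ) (α β : ℝ), 0 < α → 0 < β → IsAlgebraic ℚ α → IsAlgebraic ℚ β → (∀ p q : ℤ, α ^ p * β ^ q = 1 → p = 0 ∧ q = 0) → ∀ (k k' : ℕ) (u v u₁ v₁ : Fin k → Fin n →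 ℤ) (s t s₁ t₁ : Fin k' → Fin n → ℤ) (r : Fin k → KZ.IntegralRep (n + 1)) (r' : Fin k' → KZ.IntegralRep (n + 1)), (∀ i j, α ^ u i j * β ^ v i j < α ^ u₁ i j * β ^ v₁ i j) → (∀ i j, α ^ s i j * β ^ t i j < α ^ s₁ i j * β ^ t₁ i j) → (∀ i, (r i).domain = {p : Fin (n + 1) → ℝ | (∀ j : Fin n, α ^ u i j * β ^ v i j < p (Fin.castSucc j) ∧ p (Fin.castSucc j) < α ^ u₁ i j * β ^ v₁ i j) ∧ 0 < p (Fin.last n) ∧ p (Fin.last n) * ∏ j : Fin n, p (Fin.castSucc j) < 1}) → (∀ i, ∀ p ∈ (r i).domain, (r i).integrand p = 1) → (∀ i, (r' i).domain = {p : Fin (n + 1) → ℝ | (∀ j : Fin n, α ^ s i j * β ^ t i j < p (Fin.castSucc j) ∧ p (Fin.castSucc j) < α ^ s₁ i j * β ^ t₁ i j) ∧ 0 < p (Fin.last n) ∧ p (Fin.last n) * ∏ j : Fin n, p (Fin.castSucc j) < 1}) → (∀ i, ∀ p ∈ (r' i).domain, (r' i).integrand p = 1) → ∑ i, (r i).value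 = ∑ i, (r' i).value → ∑ i, KZ.of (r i) - ∑ i, KZ.of (r' i) ∈ KZ.relations)) : ∀ (n : ℕ) (α β : ℝ), 0 < α → 0 < β → IsAlgebraic ℚ α → IsAlgebraic ℚ β → (∀ p q : ℤ, α ^ p * β ^ q = 1 → p = 0 ∧ q = 0) → ∀ (k k' : ℕ) (u v u₁ v₁ : Fin k → Fin n → ℤ) (s t s₁ t₁ : Fin k' → Fin n → ℤ) (r r' : KZ.IntegralRep (n + 1)), (∀ i j, α ^ u i j * β ^ v i j < α ^ u₁ i j * β ^ v₁ i j) → (∀ i j, α ^ s i j * β ^ t i j < α ^ s₁ i j * β ^ t₁ i j) → r.domain = (⋃ i, {ξ : Fin (n + 1) → ℝ | (∀ ι : Fin n, (fun j => α ^ u i j * β ^ v i j) ι < ξ (Fin.castSucc ι) ∧ ξ (Fin.castSucc ι) < (fun j => α ^ u₁ i j * β ^ v₁ i j) ι) ∧ 0 < ξ (Fin.last n) ∧ ξ (Fin.last n) * ∏ ι : Fin n, ξ (Fin.castSucc ι) < 1}) → (∀ i i', i ≠ i' → Disjoint {ξ : Fin (n + 1) → ℝ | (∀ ι : Fin n,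 (fun j => α ^ u i j * β ^ v i j) ι < ξ (Fin.castSucc ι) ∧ ξ (Fin.castSucc ι) < (fun j => α ^ u₁ i j * β ^ v₁ i j) ι) ∧ 0 < ξ (Fin.last n) ∧ ξ (Fin.last n) * ∏ ι : Fin n, ξ (Fin.castSucc ι) < 1} {ξ : Fin (n + 1) → ℝ | (∀ ι : Fin n, (fun j => α ^ u i' j * β ^ v i' j) ι < ξ (Fin.castSucc ι) ∧ ξ (Fin.castSucc ι) < (fun j => α ^ u₁ i' j * β ^ v₁ i' j) ι) ∧ 0 < ξ (Fin.last n) ∧ ξ (Fin.last n) * ∏ ι : Fin n, ξ (Fin.castSucc ι) < 1}) → (∀ x ∈ r.domain, r.integrand x = 1) → r'.domain = (⋃ i, {ξ : Fin (n + 1) → ℝ | (∀ ι : Fin n, (fun j => α ^ s i j * β ^ t i j) ι < ξ (Fin.castSucc ι) ∧ ξ (Fin.castSucc ι) < (fun j => α ^ s₁ i j * β ^ t₁ i j) ι) ∧ 0 < ξ (Fin.last n) ∧ ξ (Fin.last n) * ∏ ι : Fin n, ξ (Fin.castSucc ι) < 1}) → (∀ i i', i ≠ i' → Disjoint {ξ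 : Fin (n + 1) → ℝ | (∀ ι : Fin n, (fun j => α ^ s i j * β ^ t i j) ι < ξ (Fin.castSucc ι) ∧ ξ (Fin.castSucc ι) < (fun j => α ^ s₁ i j * β ^ t₁ i j) ι) ∧ 0 < ξ (Fin.last n) ∧ ξ (Fin.last n) * ∏ ι : Fin n, ξ (Fin.castSucc ι) < 1} {ξ : Fin (n + 1) → ℝ | (∀ ι : Fin n, (fun j => α ^ s i' j * β ^ t i' j) ι < ξ (Fin.castSucc ι) ∧ ξ (Fin.castSucc ι) < (fun j => α ^ s₁ i' j * β ^ t₁ i' j) ι) ∧ 0 < ξ (Fin.last n) ∧ ξ (Fin.last n) * ∏ ι : Fin n, ξ (Fin.castSucc ι) < 1}) → (∀ x ∈ r'.domain, r'.integrand x = 1) → r.value = r'.value → KZ.Equivalent r r' := by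
  intro n α β hα hβ hαa hβa hind k k' u v u₁ v₁ s t s₁ t₁ r r' hlt hlt' hrd hdisj hr hrd' hdisj' hr' hv
  -- representations on the boxes
  have halg : ∀ (uu vv : Fin n → ℤ) (j : Fin n), IsAlgebraic ℚ (α ^ uu j * β ^ vv j) := by
    intro uu vv j
    refine IsAlgebraic.mul ?_ ?_
    · cases uu j with
      | ofNat m => simpa using hαa.pow m
      | negSucc m => rw [zpow_negSucc]; exact (hαa.pow (m + 1)).inv
    · cases vv j with
      | ofNat m => simpa using hβa.pow m
      | negSucc m => rw [zpow_negSucc]; exact (hβa.pow (m + 1)).inv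
  have hpos : ∀ (uu vv : Fin n → ℤ) (j : Fin n), 0 < α ^ uu j * β ^ vv j :=
    fun uu vv j => mul_pos (zpow_pos hα _) (zpow_pos hβ _)
  choose R hRd hRi using fun i : Fin k => hEx n (fun j => α ^ u i j * β ^ v i j)
    (fun j => α ^ u₁ i j * β ^ v₁ i j) (hpos (u i) (v i)) (halg (u i) (v i)) (halg (u₁ i) (v₁ i))
  choose R' hR'd hR'i using fun i : Fin k' => hEx n (fun j => α ^ s i j * β ^ t i j)
    (fun j => α ^ s₁ i j * β ^ t₁ i j) (hpos (s i) (t i)) (halg (s i) (t i)) (halg (s₁ i) (t₁ i))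
  have hR : ∀ i, ∀ x ∈ (R i).domain, (R i).integrand x = 1 := fun i x _ => by rw [hRi i]
  have hR' : ∀ i, ∀ x ∈ (R' i).domain, (R' i).integrand x = 1 := fun i x _ => by rw [hR'i i]
  obtain ⟨h₁, hv₁⟩ := toric_split_union (fun i j => α ^ u i j * β ^ v i j)
    (fun i j => α ^ u₁ i j * β ^ v₁ i j) r R hrd hdisj hr hRd hR
  obtain ⟨h₂, hv₂⟩ := toric_split_union (fun i j => α ^ s i j * β ^ t i j)
    (fun i j => α ^ s₁ i j * β ^ t₁ i j) r' R' hrd' hdisj' hr' hR'd hR'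
  have h₃ : ∑ i, KZ.of (R i) - ∑ i, KZ.of (R' i) ∈ KZ.relations :=
    hRTB n α β hα hβ hαa hβa hind k k' u v u₁ v₁ s t s₁ t₁ R R' hlt hlt' hRd hR hR'd hR'
      (by rw [← hv₁, ← hv₂, hv])
  have : KZ.of r - KZ.of r' = (KZ.of r - ∑ i, KZ.of (R i)) +
      (∑ i, KZ.of (R i) - ∑ i, KZ.of (R' i)) - (KZ.of r' - ∑ i, KZ.of (R' i)) := by abel
  show KZ.of r - KZ.of r' ∈ KZ.relations
  rw [this]
  exact KZ.relations.sub_mem (KZ.relations.add_mem h₁ h₃) h₂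

end Summit.KontsevichZagierPeriods.SymplecticScissors.LogPolytope

end
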